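import Mathlib
import HarnessLib

/-!
# Route `AxisTwistDoor`, crux `AveragedConeLiouville` (stmt-NavierStokesRegularity-26889) — INPUT N4
# (Nazarov–Ural'tseva 2011, propagation of positivity with a divergence-free drift): the DE GIORGI
# CLASS of the axis-free chain — DEFINITIONS (piece P0 of the N4 cut of record, pub/ns-inputs
# STATUS 2026-08-28T11:29:42Z)

Target of the chain (T0): `PositivityPropagationFactC` (`…AxisTwistDoorAveragedConeLiouvilleDefs`),
the classical closed-cylinder form of Nazarov–Ural'tseva, Algebra i Analiz 23:1 (2011) = St.
Petersburg Math. J. 23 (2012) 93–115 = arXiv:1011.1888, §3 (Lemma 3.1–3.4, Cor 3.1–3.3) = Lei–Ren–Tian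
arXiv:2501.08976 Lemma 2.5, consumed by the registered stub `stub_positivityOfNU` (p624718); then
(T1) the typed Literature fact `NazarovUraltseva2011_positivity_propagation (EuclideanSpace ℝ (Fin 3))`.

DESIGN (why these texts). The tree already holds the complete De Giorgi–Nash–Moser chain of N–U §3 in
Seregin's class 𝒱 (the A1 programme, files `…AxisymmetricKatoGlobalStubSeregin2020TypeIILemma22*`,
atoms `lemma22_moserStep` / `lemma22_smallSublevel_lowerBound` / `lemma22_densityPropagation` /
`lemma22_shrinking`, composition `lemma22_expansionOfPositivity_of_atoms`). Those atoms cannot be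
APPLIED to a standard supersolution of `∂ₜV − ΔV + b·∇V ≥ 0`: their energy class carries the AXIS
TERM `∫∫ η (2/ϱ) H(Φ) ∂_{e_ϱ}(Θ²)` for every cut-off `Θ` on balls centred ON the axis, which has no
sign for a general `Θ` and cannot be absorbed into the drift class (`1/ϱ ∉ L³`). The present
definitions are therefore the A1 texts `EnergyClass` / `Standing` (skeleton
`Cruxes/AxisymmetricKatoGlobal/Seregin2020Lemma22ExpansionOfPositivity.lean`, v3/v4) with exactly
three edits: the axis integral is DELETED from the energy class; the axis set `S` and its two
clauses are DELETED from the standing hypotheses (continuity is asked on the whole half-space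
`{t < 0} × ℝ³`); nothing else changes — in particular the FRAME `]-R², 0[ × B(0, 2R)`, the drift
class `∫_{-R²}^0 (∫_{B(2R)} |U|³)^{4/3} ≤ N R²` (a drift bounded by `Λ` on the frame satisfies it with
`N = 16 |B₁|^{4/3} Λ⁴` when `R ≤ 1`) and the level cap `k` (`H = 0` on `[k, ∞)`) are kept VERBATIM,
so that the four analytic atoms are re-instantiated from the A1 files by deleting the axis-term
steps, and every sign-agnostic tool (cut-offs, test powers, Moser algebra/embedding, iteration,
level-set slices, De Giorgi's isoperimetric inequality) is used BY NAME. A classical supersolution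
on `]0,T[ × B(0,1)` is put into this frame by the time cut-off `ψ(t) V` (a supersolution again, since
`V ≥ 0` and `ψ' ≥ 0`; it vanishes for small `t`, so frames may extend below `t = 0`), a space cut-off
outside the balls used, and a time translation (piece N-W′).

No NS-regularity statement is touched: N4 is an INPUT (a printed theorem re-proved in the kernel);
item 26889 and the summit stay open.

## References
* A. I. Nazarov, N. N. Ural'tseva, Algebra i Analiz 23:1 (2011) 136–168 = St. Petersburg Math. J.
  23 (2012) 93–115, arXiv:1011.1888, §3. [cite: NazarovUraltseva2011HarnackDivFree, §3 (arXiv pp. 8–10)]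
* Z. Lei, X. Ren, G. Tian, arXiv:2501.08976, Lemma 2.5. [cite: LeiRenTian2025, Lemma 2.5 (arXiv p.7)]
-/

noncomputable section

-- the summit and its single sub-problem share the name (CONVENTIONS §1)
set_option linter.dupNamespace false

open MeasureTheory Set Function Metric
open scoped NNReal ENNReal

namespace Summit.NavierStokesRegularity.NavierStokesRegularity.Theorems.AveragedConeLiouville.NUPositivity

/-- **The axis-free energy class** (N–U 2011 §3, (3.2)/(3.9) before the choice of the cut-off; A1's
`EnergyClass` v3 with the axis integral deleted): for every `H ∈ C²(ℝ)` with `H' ≤ 0 ≤ H`, `H'' ≥ 0`,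
`H'² ≤ 2HH''` and `H = 0` on `[k,∞)`, every `Θ ∈ C¹_c` with `tsupport Θ ⊆ B(0, 2R)`, every `η ∈ C¹`,
`η ≥ 0`, and all `-R² < t₁ ≤ t₂ < 0`:
`η(t₂)M(t₂) + ½∫∫ η H''(Φ)|∇Φ|²Θ² ≤ η(t₁)M(t₁) + 4∫∫ ηH(Φ)|∇Θ|² + ∫∫ ηH(Φ)⟪U,∇Θ²⟫ + ∫∫ |η'|H(Φ)Θ²`,
`M(t) = ∫ H(Φ(t,x))Θ(x)² dx`, the dissipation as a `lintegral`, the three right-hand terms as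
separate Bochner integrals over the slab `[t₁,t₂] × ℝ³`.
[cite: NazarovUraltseva2011HarnackDivFree, §3 (3.2), (3.9) (arXiv pp. 8–9)] -/
def NUEnergyClass (Φ : ℝ → EuclideanSpace ℝ (Fin 3) → ℝ)
    (U : ℝ → EuclideanSpace ℝ (Fin 3) → EuclideanSpace ℝ (Fin 3)) (k R : ℝ) : Prop :=
  ∀ (H : ℝ → ℝ), ContDiff ℝ 2 H → (∀ v, deriv H v ≤ 0) → (∀ v, 0 ≤ H v) →
    (∀ v, 0 ≤ deriv (deriv H) v) → (∀ v, deriv H v ^ 2 ≤ 2 * H v * deriv (deriv H) v) →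
    (∀ v, k ≤ v → H v = 0) →
  ∀ (Θ : EuclideanSpace ℝ (Fin 3) → ℝ), ContDiff ℝ 1 Θ → HasCompactSupport Θ →
    tsupport Θ ⊆ ball (0 : EuclideanSpace ℝ (Fin 3)) (2 * R) →
  ∀ (η : ℝ → ℝ), ContDiff ℝ 1 η → (∀ s, 0 ≤ η s) →
  ∀ (t₁ t₂ : ℝ), -R ^ 2 < t₁ → t₁ ≤ t₂ → t₂ < 0 →
    ENNReal.ofReal (η t₂ * ∫ x, H (Φ t₂ x) * Θ x ^ 2) +
      ∫⁻ z in Icc t₁ t₂ ×ˢ (univ : Set (EuclideanSpace ℝ (Fin 3))), ENNReal.ofReal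
        (1 / 2 * η z.1 * (deriv (deriv H) (Φ z.1 z.2) * ‖gradient (Φ z.1) z.2‖ ^ 2 * Θ z.2 ^ 2))
    ≤ ENNReal.ofReal (η t₁ * (∫ x, H (Φ t₁ x) * Θ x ^ 2) +
        (4 * ∫ z in Icc t₁ t₂ ×ˢ (univ : Set (EuclideanSpace ℝ (Fin 3))),
          η z.1 * (H (Φ z.1 z.2) * ‖gradient Θ z.2‖ ^ 2)) +
        (∫ z in Icc t₁ t₂ ×ˢ (univ : Set (EuclideanSpace ℝ (Fin 3))),
          η z.1 * (H (Φ z.1 z.2) * inner ℝ (U z.1 z.2) (gradient (fun y => Θ y ^ 2) z.2))) +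
        (∫ z in Icc t₁ t₂ ×ˢ (univ : Set (EuclideanSpace ℝ (Fin 3))),
          |deriv η z.1| * (H (Φ z.1 z.2) * Θ z.2 ^ 2)))

/-- **Standing hypotheses of the axis-free De Giorgi chain** at scale `R`, level cap `k`, drift
constant `N` (A1's `Standing` with the axis set removed): measurability, continuity on the half-space
`{t < 0}`, nonnegativity, a.e.-`t` `C¹` slices on the frame window, the drift class
`∫_{-R²}^0 (∫_{B(2R)} |U|³)^{4/3} ≤ N R²` (N–U `q = 3`, `ℓ = 4`), and the energy class.
[cite: NazarovUraltseva2011HarnackDivFree, §3 (arXiv p. 8)] -/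
def NUStanding (Φ : ℝ → EuclideanSpace ℝ (Fin 3) → ℝ)
    (U : ℝ → EuclideanSpace ℝ (Fin 3) → EuclideanSpace ℝ (Fin 3)) (k R : ℝ) (N : ℝ≥0) : Prop :=
  0 < k ∧ 0 < R ∧ Measurable (uncurry Φ) ∧ AEStronglyMeasurable (uncurry U) volume ∧
  ContinuousOn (uncurry Φ) {z : ℝ × EuclideanSpace ℝ (Fin 3) | z.1 < 0} ∧
  (∀ t x, 0 ≤ Φ t x) ∧
  (∀ᵐ t : ℝ, t ∈ Ioo (-R ^ 2) 0 → ContDiff ℝ 1 (Φ t)) ∧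
  (∫⁻ s in Ioo (-R ^ 2) 0, (∫⁻ y in ball (0 : EuclideanSpace ℝ (Fin 3)) (2 * R),
      ‖U s y‖ₑ ^ (3 : ℕ)) ^ (4 / 3 : ℝ) ≤ (N : ℝ≥0∞) * ENNReal.ofReal R ^ 2) ∧
  NUEnergyClass Φ U k R

/-- The standing hypotheses give the energy class (projection, for consumers). -/
theorem NUStanding.energyClass {Φ : ℝ → EuclideanSpace ℝ (Fin 3) → ℝ}
    {U : ℝ → EuclideanSpace ℝ (Fin 3) → EuclideanSpace ℝ (Fin 3)} {k R : ℝ} {N : ℝ≥0}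
    (h : NUStanding Φ U k R N) : NUEnergyClass Φ U k R :=
  h.2.2.2.2.2.2.2.2

/-- The standing hypotheses give `0 < k` and `0 < R` (projection, for consumers). -/
theorem NUStanding.pos {Φ : ℝ → EuclideanSpace ℝ (Fin 3) → ℝ}
    {U : ℝ → EuclideanSpace ℝ (Fin 3) → EuclideanSpace ℝ (Fin 3)} {k R : ℝ} {N : ℝ≥0}
    (h : NUStanding Φ U k R N) : 0 < k ∧ 0 < R :=
  ⟨h.1, h.2.1⟩

end Summit.NavierStokesRegularity.NavierStokesRegularity.Theorems.AveragedConeLiouville.NUPositivity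

end
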